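import Mathlib.LinearAlgebra.FiniteDimensional.Lemmas
import Literature.Computability.AlgebraicComplexity.TensorRankSliceSpan
import Literature.Computability.AlgebraicComplexity.TensorRankFactsProofs

/-!
# ω-census (abelian STPP census, seat stpp-2), filter N7 part 1: the projection lemma behind Strassen's additivity problem

HONEST FRAMING (pub-omega census; verbatim): lottery ticket; floor = certified bounds/negative ranges.
Census BOOKKEEPING (pub-omega stpp-2 gen 16, 2026-08-26): the linear-algebra lemma behind the census filter N7
(`STPPRankPeel.lean`, `STPPThinFamilies.lean`), in the kernel.  Nothing here is progress on `ω`.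

Buczyński–Postinghel–Rupniewski, *On Strassen's rank additivity for small three-way tensors*, SIAM J. Matrix Anal.
Appl. 41 (2020), arXiv:1902.06582, §3.1, first Lemma (`R(W') + e'' ≤ R(W) − dim W''`, any field; here with `e'' ≥ 0`
dropped): for a block-diagonal 3-tensor `t` (entries whose three indices are not all on the same side of a partition
vanish), `R(lower block) + dim span(first-index slices of the upper block) ≤ R(t)` — `STPPRank.peel`.  Proof as
printed, on top of Landsberg's slice criterion (the tree's `tensorRank_le_iff_exists_forall_slice_mem_span`): a space
spanned by `R(t)` rank-one matrices containing all slices contains the padded upper slices, which die under the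
projection to the lower block; the projected space has dimension `≤ R(t) − dim W''`, is spanned by rank-`≤ 1` matrices
and contains the lower slices; extract a basis.  Also `STPPRank.linearIndependent_of_delta` (a family of matrices with
private coordinates is linearly independent), used downstream to evaluate the flattening ranks of matrix
multiplication blocks.
-/

noncomputable section

open scoped BigOperators

namespace Summit.MatrixMultiplication.OmegaCensus.STPPRank

open Literature.Computability.AlgebraicComplexity Module Finset

/-! ## The projection lemma (BPR 2020, §3.1) -/

section Peel

variable {K : Type*} [Field K] {ι κ μ : Type*} [Fintype ι] [Fintype κ] [Fintype μ]
  (p : ι → Prop) (q : κ → Prop) (r : μ → Prop) [DecidablePred p] [DecidablePred q] [DecidablePred r]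

/-- Block-diagonal shape with respect to the predicates `p, q, r`: an entry whose three indices do not all lie on the
same side vanishes. [cite: BuczynskiPostinghelRupniewski2020, §3 (direct sum tensors)] -/
def BlockVanishing (t : ι → κ → μ → K) : Prop :=
  ∀ a b c, ¬ ((p a ↔ q b) ∧ (q b ↔ r c)) → t a b c = 0

/-- The lower block `t|_{¬p × ¬q × ¬r}`. [cite: BuczynskiPostinghelRupniewski2020, §3] -/
def lowerBlock (t : ι → κ → μ → K) : {a // ¬ p a} → {b // ¬ q b} → {c // ¬ r c} → K :=
  fun a b c => t a b c

/-- The first-index slices of the upper block `t|_{p × q × r}`. [cite: BuczynskiPostinghelRupniewski2020, §3.1] -/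
def upperSlice (t : ι → κ → μ → K) (a : {a // p a}) : {b // q b} → {c // r c} → K :=
  fun b c => t a b c

/-- Restriction of a `κ × μ` matrix to the lower block (a linear map). [folklore] -/
def projLower : (κ → μ → K) →ₗ[K] ({b // ¬ q b} → {c // ¬ r c} → K) where
  toFun M := fun b c => M b c
  map_add' _ _ := rfl
  map_smul' _ _ := rfl

/-- Zero-padding of an upper-block matrix to a `κ × μ` matrix (a linear map). [folklore] -/
def padUpper : ({b // q b} → {c // r c} → K) →ₗ[K] (κ → μ → K) where
  toFun N := fun b c => if hb : q b then (if hc : r c then N ⟨b, hb⟩ ⟨c, hc⟩ else 0) else 0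
  map_add' N N' := by
    funext b c
    simp only [Pi.add_apply]
    split_ifs <;> simp
  map_smul' x N := by
    funext b c
    simp only [Pi.smul_apply, smul_eq_mul, RingHom.id_apply]
    split_ifs <;> simp

omit [Fintype κ] [Fintype μ] in
/-- The projection kills padded upper matrices. [folklore] -/
theorem projLower_padUpper (N : {b // q b} → {c // r c} → K) :
    projLower q r (K := K) (padUpper q r N) = 0 := by
  funext b c
  simp [projLower, padUpper, b.2]

omit [Fintype κ] [Fintype μ] in
/-- Zero-padding is injective. [folklore] -/
theorem padUpper_injective : Function.Injective (padUpper q r (K := K)) := by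
  intro N N' h
  funext b c
  have := congr_fun (congr_fun h b.1) c.1
  simpa [padUpper, b.2, c.2] using this

omit [Fintype ι] [Fintype κ] [Fintype μ] [DecidablePred p] in
/-- An upper slice of a block-diagonal tensor, padded, is the corresponding slice of `t`. [folklore] -/
theorem padUpper_upperSlice {t : ι → κ → μ → K} (ht : BlockVanishing p q r t) (a : {a // p a}) :
    padUpper q r (upperSlice p q r t a) = t a := by
  funext b c
  simp only [padUpper, upperSlice, LinearMap.coe_mk, AddHom.coe_mk]
  by_cases hb : q b
  · by_cases hc : r c
    · simp [hb, hc]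
    · simp only [hb, hc, dif_pos, dif_neg, not_false_eq_true]
      exact (ht a b c (by tauto)).symm
  · simp only [hb, dif_neg, not_false_eq_true]
    have := a.2
    exact (ht a b c (by tauto)).symm

/-- **The projection lemma** (Buczyński–Postinghel–Rupniewski 2020, §3.1, first Lemma, with `e'' ≥ 0` dropped):
for a block-diagonal tensor `t`, the rank of the lower block plus the dimension of the span of the first-index
slices of the upper block (an upper flattening rank) is at most `R(t)`.  Proof as printed: a space `V` spanned by
`R(t)` rank-one matrices containing all slices of `t` contains the padded upper slices, which die under the
projection to the lower block, so the projection of `V` — spanned by rank-`≤ 1` matrices and containing the lower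
slices — has dimension `≤ R(t) − dim W''`; extract a basis (Landsberg's slice criterion,
`tensorRank_le_iff_exists_forall_slice_mem_span`). [cite: BuczynskiPostinghelRupniewski2020, §3.1 (first Lemma)] -/
theorem peel {t : ι → κ → μ → K} (ht : BlockVanishing p q r t) :
    tensorRank (lowerBlock p q r t) +
        finrank K (Submodule.span K (Set.range (upperSlice p q r t))) ≤ tensorRank t := by
  classical
  set R := tensorRank t with hR
  obtain ⟨u, v, hS⟩ := (tensorRank_le_iff_exists_forall_slice_mem_span t R).1 le_rfl
  set φ : Fin R → κ → μ → K := fun l b c => u l b * v l c with hφ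
  set S : Submodule K (κ → μ → K) := Submodule.span K (Set.range φ) with hSdef
  set P := projLower q r (K := K) with hP
  set E := padUpper q r (K := K) with hE
  set U : Submodule K ({b // q b} → {c // r c} → K) := Submodule.span K (Set.range (upperSlice p q r t))
  set W₂ : Submodule K (κ → μ → K) := U.map E with hW₂
  -- the padded upper slices lie in `S` and in `ker P`
  have hW₂S : W₂ ≤ S := by
    rw [hW₂, Submodule.map_span, Submodule.span_le]
    rintro _ ⟨_, ⟨a, rfl⟩, rfl⟩
    rw [hE, padUpper_upperSlice p q r ht a]
    exact hS a
  have hW₂K : W₂ ≤ LinearMap.ker P := by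
    rw [hW₂, Submodule.map_span, Submodule.span_le]
    rintro _ ⟨_, ⟨a, rfl⟩, rfl⟩
    rw [SetLike.mem_coe, LinearMap.mem_ker, hP, hE]
    exact projLower_padUpper q r _
  -- dimensions
  have hSdim : finrank K S ≤ R := by
    have h := finrank_range_le_card (R := K) φ
    simpa [Set.finrank] using h
  have hsplit : finrank K (S.map P) + finrank K W₂ ≤ finrank K S := by
    have h1 := LinearMap.finrank_range_add_finrank_ker (P.domRestrict S)
    rw [LinearMap.range_domRestrict, LinearMap.ker_domRestrict] at h1
    have h2 : finrank K W₂ ≤ finrank K ((LinearMap.ker P).comap S.subtype) :=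
      calc finrank K W₂ = finrank K (W₂.comap S.subtype) :=
            (Submodule.comapSubtypeEquivOfLe hW₂S).finrank_eq.symm
        _ ≤ finrank K ((LinearMap.ker P).comap S.subtype) :=
            Submodule.finrank_mono (Submodule.comap_mono hW₂K)
    omega
  have hW₂dim : finrank K W₂ = finrank K U := (Submodule.equivMapOfInjective E (padUpper_injective q r) U).finrank_eq.symm
  -- the projected space is spanned by the projected rank-one matrices and contains the lower slices
  have hSP : S.map P = Submodule.span K (Set.range (P ∘ φ)) := by
    rw [hSdef, Submodule.map_span, Set.range_comp]
  have hlow : ∀ a, (lowerBlock p q r t a : {b // ¬ q b} → {c // ¬ r c} → K) ∈ S.map P :=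
    fun a => ⟨t a, hS a, rfl⟩
  -- extract a linearly independent spanning subfamily
  obtain ⟨σ, emb, hinj, hspan, hli⟩ := exists_linearIndependent' (K := K) (P ∘ φ)
  haveI : Fintype σ := Fintype.ofInjective emb hinj
  have hcard : Fintype.card σ = finrank K (S.map P) := by
    rw [hSP, ← hspan, finrank_span_eq_card hli]
  set e := (Fintype.equivFin σ).symm with he
  have hlowRank : tensorRank (lowerBlock p q r t) ≤ Fintype.card σ := by
    refine (tensorRank_le_iff_exists_forall_slice_mem_span _ _).2
      ⟨fun i b => u (emb (e i)) b.1, fun i c => v (emb (e i)) c.1, fun a => ?_⟩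
    have hrange : (Set.range fun i : Fin (Fintype.card σ) =>
        fun (b : {b // ¬ q b}) (c : {c // ¬ r c}) => u (emb (e i)) b.1 * v (emb (e i)) c.1) =
        Set.range ((P ∘ φ) ∘ emb) := by
      ext x
      constructor
      · rintro ⟨i, rfl⟩
        exact ⟨e i, rfl⟩
      · rintro ⟨s, rfl⟩
        exact ⟨e.symm s, by simp [he, hP, hφ, projLower]⟩
    rw [hrange, hspan, ← hSP]
    exact hlow a
  calc tensorRank (lowerBlock p q r t) + finrank K U
      ≤ Fintype.card σ + finrank K W₂ := by rw [hW₂dim]; exact Nat.add_le_add_right hlowRank _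
    _ = finrank K (S.map P) + finrank K W₂ := by rw [hcard]
    _ ≤ finrank K S := hsplit
    _ ≤ R := hSdim

end Peel

/-! ## §2 Direct sums of matrix multiplication tensors: peeling one block in a chosen direction -/

section Delta

variable {K : Type*} [Field K]

/-- A family of matrices with a "private coordinate" each (`v a` is `1` at `(b₀ a, c₀ a)` where every other member
vanishes) is linearly independent. [folklore] -/
theorem linearIndependent_of_delta {α β γ : Type*} [DecidableEq α] (v : α → β → γ → K) (b₀ : α → β)
    (c₀ : α → γ) (h : ∀ a a', v a (b₀ a') (c₀ a') = if a = a' then 1 else 0) : LinearIndependent K v := by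
  rw [linearIndependent_iff']
  intro S g hg a' ha'
  have := congr_fun (congr_fun hg (b₀ a')) (c₀ a')
  simp only [Finset.sum_apply, Pi.smul_apply, smul_eq_mul, Pi.zero_apply, h, mul_ite, mul_one, mul_zero,
    Finset.sum_ite_eq', ha', if_true] at this
  exact this

end Delta

end Summit.MatrixMultiplication.OmegaCensus.STPPRank

end
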